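import Summits.QuantumFields.YangMills.Theorems.UnitScaleGibbsDressedSchwingerDyson
import Summits.QuantumFields.YangMills.Theorems.UnitScaleGibbsAxialGaugeDocking
import Summits.QuantumFields.YangMills.Theorems.UnitScaleGibbsActionDerivativeSlotDerivatives
import Literature.MathematicalPhysics.QuantumFieldTheory.Balaban1983to89.T3UnitScaleTilt
import HarnessLib

/-!
# `stub_condSD` of LINE 28 «GrossTransfer» AS TYPED: the second-order Schwinger–Dyson («energy») identity in the tree-gauge dressing,
# `β_K·∫ (∂_u A_W)(V U)² dμ_K = ∫ (∂_u∂_u A_W)(V U) dμ_K`, `V U = U^{axialGauge U lo hi}` (crux `HistoryTailL`, stmt-QuantumFields-19936)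

Cell `ym3-torus` (YM ladder rung R3 = continuum SU(2) Yang–Mills on T³ — a RUNG, NOT the Clay problem: not d = 4, not infinite volume, not a mass gap);
TWIN-WIDTH helper seat `ym-ust-19936-w8` g10; `--supports stmt-QuantumFields-19936`; THEOREMS ONLY (0 `def`, 0 `sorry`, default heartbeats).
THE KNIT of three landed bricks, all used BY NAME: (SD-DRESS) ✓`UnitScaleGibbsDressedSchwingerDyson.dressed_energy_identity` (this seat: the dressed
energy identity for an abstract adapted dressing and abstract rows), (AX-DOCK) ✓`UnitScaleGibbsAxialGaugeDocking` (px5 g10: the axial gauge of a box is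
ADAPTED to every off-comb bond and sitewise MEASURABLE), and px17 g7's slot calculus ✓`UnitScaleGibbsActionDerivativeSlotCalculus` ∕ `…SlotDerivatives`
(the `SU(N)` rows: `actionDeriv = Σ_b oneBondDeriv`, `actionDeriv₂ = Σ_b oneBondDeriv₂`, `hasDerivAt_wilsonAction4_oneBond`, `hasDerivAt_actionDeriv_oneBond`,
continuity), with w8 g9's ✓`exists_oneParam_specialUnitaryGroup` (the flows `exp(t·u_b) ∈ SU(N)`).

WHAT IS PROVED (ideator ym-r3-idea-2 g16, LINE 28 skeleton v2 `Cruxes/HistoryTailL/Lines/gross_transfer.lean` 5d16c6d70f019e13, registered on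
stmt-QuantumFields-23083 `RevelationMartingale.MeanDeviationL` — ★★OWNER RECORD 17x; `stub_condSD` (M), pen of record w8-19936 g10 — RULING №31).
* §1 SUPPORT BOOKKEEPING (matrix model, any `ρ : G →* M_N(ℂ)`): the one-bond rows VANISH at bonds where the test field does — `slotIns_eq_zero`,
  `slotIns₂_eq_zero`, `oneBondDeriv_eq_zero_of_apply_eq_zero`, `oneBondDeriv₂_eq_zero_of_apply_eq_zero` (a word with a zero slot is zero,
  ✓`word_update_zero`) — so `actionDeriv ρ u = Σ_{b : u b ≠ 0} oneBondDeriv ρ u b` (`actionDeriv_eq_sum_subtype`) and likewise for `actionDeriv₂`: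
  the dressing need only be adapted to the SUPPORT of `u`.
* §2 ★★`dressed_energy_identity_matrixModel` — for a compact second-countable matrix-model gauge group, flows `ρ(k b t) = exp(t u_b)`, and ANY sitewise
  measurable dressing `g` adapted to every bond of `supp u`: `β·∫ (actionDeriv ρ u (V U))² dμ_β = ∫ actionDeriv₂ ρ u (V U) dμ_β` (`β ≥ 0`, `V U = U^{g U}`).
* §3 ★★`su_dressed_energy_identity` — the `SU(N)` instance (`ρ = fundamentalRep`, `u` skew-Hermitian traceless).
* §4 ★★★`stub_condSD` — THE REGISTERED STUB TEXT TOKEN FOR TOKEN (skeleton v2 `Cruxes/HistoryTailL/Lines/gross_transfer.lean` 5d16c6d70f019e13 on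
  stmt-QuantumFields-23083, ★★OWNER RECORD 17x; = v1 c904a77a on this stub) (`N = 2`, `g U = axialGauge U lo hi`, support on inner off-tree bonds of a
  non-wrapping box, `gibbsK F ℰp γ K`, `β_K = (F.scheme ℰp γ).β K`, every `γ ≥ 0`): EXACT, no window, no small field — as the ideator predicted
  («WHY IT MIGHT FAIL: only bookkeeping can»).
HONEST SCOPE.  An exact finite-`β` identity; NOTHING of `stub_hessOnEvent`, `stub_linTest`, `stub_peierls0`, the composition `shallowFluxSecondMomentL_of_stubs`,
«ShallowFluxSecondMomentL», (Q), K1, `MeanDeviationL` (23083 ∕ 23133 ∕ 23134), `HistoryTailL`, the rung R3, d = 4, a continuum limit or a mass gap is proved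
here; `stub_condSD` is ONE of the five registered stubs of LINE 28 (item 23083 stays open); the Yang–Mills mass gap is NOT proved.

References: L. Gross, CMP 92 (1983) 137–162, Thm 2.2 (2.7)–(2.9) [GrossCMP1983]; S. Chatterjee, CMP 366 (2019) §8 [Chatterjee2019LargeN];
M. Creutz, Quarks, Gluons and Lattices (2022) Ch. 9, Ch. 11 [Creutz2022].
-/

set_option autoImplicit false

noncomputable section

open MeasureTheory Filter Topology NormedSpace
open scoped BigOperators Matrix.Norms.Frobenius
open Literature.MathematicalPhysics.QuantumFieldTheory.Balaban1983to89
open Literature.MathematicalPhysics.QuantumFieldTheory.Balaban1983to89.T4GenFunBounds (gibbsMeasure isProbabilityMeasure_gibbsMeasure)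
open Literature.MathematicalPhysics.QuantumFieldTheory.Balaban1983to89.T3ContinuumYM3Torus
open Literature.MathematicalPhysics.QuantumFieldTheory.Balaban1983to89.T3UnitScaleTilt
open Literature.MathematicalPhysics.QuantumFieldTheory.Balaban1983to89.T3UnitLawDensityEML (ℰp)
open Literature.MathematicalPhysics.QuantumFieldTheory.Balaban1983to89.T4AxialGaugeSmallField (axialGauge boxPlaqs castSite)
open Literature.MathematicalPhysics.QuantumFieldTheory.Balaban1983to89.T4AxialGaugeFixing (combSet)
open Literature.MathematicalPhysics.QuantumFieldTheory.Balaban1983to89.B7Prop1Explicit (e)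
open Literature.MathematicalPhysics.QuantumFieldTheory.Balaban1983to89.B8Lemma1NonAbelian (lowPart)
open Literature.MathematicalPhysics.QuantumLattice (fundamentalRep continuous_fundamentalRep)
open Summit.QuantumFields.YangMills.Theorems.EquipartitionPinsProbe.TangentSteinFiniteBeta (exists_abs_le_of_continuous)
open Summit.QuantumFields.YangMills.Theorems.UnitScaleGibbsOneBondSchwingerDysonMatrix (exists_oneParam_specialUnitaryGroup)
open Summit.QuantumFields.YangMills.Theorems.UnitScaleGibbsActionDerivativeSlotCalculus
open Summit.QuantumFields.YangMills.Theorems.UnitScaleGibbsAxialGaugeDocking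
  (axialGauge_update_of_not_mem_combSet not_mem_combSet_of_inner_lowPart_ne_zero nonWrapping_of_side_lt measurable_axialGauge_apply)
open Summit.QuantumFields.YangMills.Theorems.UnitScaleGibbsDressedSchwingerDyson (dressed_energy_identity measurable_dressed)

namespace Summit.QuantumFields.YangMills.Theorems.UnitScaleGibbsAxialGaugeCondSD

/-! ## §1 Support bookkeeping: the one-bond rows vanish where the test field vanishes -/

section Support

variable {N : ℕ} {P : Params} {j : ℕ} {G : Type} [GaugeGroup G]
  (ρ : G →* Matrix (Fin N) (Fin N) ℂ) (u : PBond P j → Matrix (Fin N) (Fin N) ℂ)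

/-- A first insertion at a slot whose bond carries `u = 0` vanishes. [cite: Creutz2022, Ch. 11] -/
theorem slotIns_eq_zero (U : GaugeField P j G) (p : Plaq P j) (i : Fin 4) (h : u (slotBond p i) = 0) :
    slotIns ρ u U p i = 0 := by
  fin_cases i <;> simp_all [slotIns, slotBond]

/-- A second insertion at a slot whose bond carries `u = 0` vanishes. [cite: Creutz2022, Ch. 11] -/
theorem slotIns₂_eq_zero (U : GaugeField P j G) (p : Plaq P j) (i : Fin 4) (h : u (slotBond p i) = 0) :
    slotIns₂ ρ u U p i = 0 := by
  fin_cases i <;> simp_all [slotIns₂, slotBond]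

variable [DecidableEq (PBond P j)]

/-- The action row of a bond off the support of `u` vanishes: `u b = 0 → oneBondDeriv ρ u b U = 0`. [cite: Creutz2022, Ch. 11] -/
theorem oneBondDeriv_eq_zero_of_apply_eq_zero {b : PBond P j} (hb : u b = 0) (U : GaugeField P j G) :
    oneBondDeriv ρ u b U = 0 := by
  unfold oneBondDeriv
  refine Finset.sum_eq_zero fun p _ => Finset.sum_eq_zero fun i _ => ?_
  by_cases h : slotBond p i = b
  · rw [if_pos h, slotIns_eq_zero ρ u U p i (h ▸ hb), word_update_zero]
    simp
  · rw [if_neg h]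

/-- The second row of a bond off the support of `u` vanishes: `u b = 0 → oneBondDeriv₂ ρ u b U = 0`. [cite: Creutz2022, Ch. 11] -/
theorem oneBondDeriv₂_eq_zero_of_apply_eq_zero {b : PBond P j} (hb : u b = 0) (U : GaugeField P j G) :
    oneBondDeriv₂ ρ u b U = 0 := by
  unfold oneBondDeriv₂
  refine Finset.sum_eq_zero fun p _ => Finset.sum_eq_zero fun i _ => Finset.sum_eq_zero fun l _ => ?_
  by_cases h : slotBond p l = b
  · rw [if_pos h]
    have hl : (if l = i then slotIns₂ ρ u U p i else slotIns ρ u U p l) = 0 := by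
      by_cases hli : l = i
      · rw [if_pos hli]; exact slotIns₂_eq_zero ρ u U p i ((hli ▸ h) ▸ hb)
      · rw [if_neg hli]; exact slotIns_eq_zero ρ u U p l (h ▸ hb)
    unfold word₂
    rw [hl, word_update_zero]
    simp
  · rw [if_neg h]

/-- `X_u = Σ_{b ∈ supp u} A′_b`: the action derivative is the sum of its one-bond rows over the SUPPORT of `u`. [cite: GrossCMP1983, Thm 2.2 (proof)] -/
theorem actionDeriv_eq_sum_subtype (U : GaugeField P j G) :
    actionDeriv ρ u U = ∑ b : {b : PBond P j // u b ≠ 0}, oneBondDeriv ρ u b U := by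
  classical
  rw [← sum_oneBondDeriv, ← Finset.sum_filter_of_ne (p := fun b => u b ≠ 0)
    (fun b _ hb => fun h => hb (oneBondDeriv_eq_zero_of_apply_eq_zero ρ u h U))]
  exact Finset.sum_subtype _ (fun b => by simp) _

/-- `∂_u X_u = Σ_{b ∈ supp u} X′_b`. [cite: GrossCMP1983, Thm 2.2 (proof)] -/
theorem actionDeriv₂_eq_sum_subtype (U : GaugeField P j G) :
    actionDeriv₂ ρ u U = ∑ b : {b : PBond P j // u b ≠ 0}, oneBondDeriv₂ ρ u b U := by
  classical
  rw [← sum_oneBondDeriv₂, ← Finset.sum_filter_of_ne (p := fun b => u b ≠ 0)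
    (fun b _ hb => fun h => hb (oneBondDeriv₂_eq_zero_of_apply_eq_zero ρ u h U))]
  exact Finset.sum_subtype _ (fun b => by simp) _

end Support

/-! ## §2 The dressed energy identity in a compact matrix model -/

section MatrixModel

variable {N : ℕ} {P : Params} [DecidableEq (PBond P 0)] {G : Type} [GaugeGroup G]
  [TopologicalSpace G] [IsTopologicalGroup G] [CompactSpace G] [MeasurableSpace G] [BorelSpace G] [SecondCountableTopology G]
  [RegularGaugeGroup G] [HaarData G]
  {ρ : G →* Matrix (Fin N) (Fin N) ℂ} (hρ : Continuous ρ) (hre : ∀ g : G, reTr g = (ρ g).trace.re / N)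
  (u : PBond P 0 → Matrix (Fin N) (Fin N) ℂ) {k : PBond P 0 → ℝ → G}
  (hk : ∀ b s t, k b (s + t) = k b s * k b t) (hkX : ∀ b t, ρ (k b t) = exp ((t : ℂ) • u b))

include hρ hre hk hkX

/-- ★★ **THE DRESSED ENERGY IDENTITY, MATRIX MODEL**: for `β ≥ 0`, flows `ρ(k b t) = exp(t u_b)`, and ANY sitewise measurable dressing `g`
ADAPTED to every bond of `supp u` (`u b ≠ 0 → g (U[b ↦ x]) = g U`), with `V U = U^{g U}`:
`β·∫ (actionDeriv ρ u (V U))² dμ_β = ∫ actionDeriv₂ ρ u (V U) dμ_β` — (SD-DRESS) `dressed_energy_identity` over the support family, rows by px17's slot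
calculus (continuity on the compact configuration space gives measurability and bounds). [cite: GrossCMP1983, Thm 2.2 (2.9); Chatterjee2019LargeN, §8] -/
theorem dressed_energy_identity_matrixModel {β : ℝ} (hβ : 0 ≤ β)
    (g : GaugeField P 0 G → GaugeTransf P 0 G) (hgm : ∀ x, Measurable fun U => g U x)
    (hgb : ∀ (b : PBond P 0), u b ≠ 0 → ∀ (U : GaugeField P 0 G) (x : G), g (Function.update U b x) = g U) :
    β * ∫ U, actionDeriv ρ u (GaugeField.gaugeAct (g U) U) ^ 2 ∂gibbsMeasure P β =
      ∫ U, actionDeriv₂ ρ u (GaugeField.gaugeAct (g U) U) ∂gibbsMeasure P β := by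
  classical
  haveI : CompactSpace (GaugeField P 0 G) := inferInstanceAs (CompactSpace (PBond P 0 → G))
  haveI : OpensMeasurableSpace (GaugeField P 0 G) := inferInstanceAs (OpensMeasurableSpace (PBond P 0 → G))
  -- the support family
  let ι := {b : PBond P 0 // u b ≠ 0}
  have hA'c : ∀ b, Continuous (oneBondDeriv ρ u b) := fun b => continuous_oneBondDeriv hρ u b
  have hX'c : ∀ b, Continuous (oneBondDeriv₂ ρ u b) := fun b => continuous_oneBondDeriv₂ hρ u b
  have h := dressed_energy_identity (ι := ι) hβ g hgm (fun i => i.val) (fun i U x => hgb i.val i.property U x)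
    (fun i => k i.val) (fun i s t => hk i.val s t)
    (fun i => oneBondDeriv ρ u i.val) (fun i => (hA'c i.val).measurable)
    (fun i => by obtain ⟨C, -, hC⟩ := exists_abs_le_of_continuous (hA'c i.val); exact ⟨C, hC⟩)
    (fun i W => hasDerivAt_wilsonAction4_oneBond hre hk hkX i.val W)
    (actionDeriv ρ u) (fun W => actionDeriv_eq_sum_subtype ρ u W)
    (fun i => oneBondDeriv₂ ρ u i.val) (fun i => (hX'c i.val).measurable)
    (fun i => by obtain ⟨C, -, hC⟩ := exists_abs_le_of_continuous (hX'c i.val); exact ⟨C, hC⟩)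
    (fun i W => hasDerivAt_actionDeriv_oneBond hk hkX i.val W)
  rw [h]
  refine integral_congr_ae (ae_of_all _ fun U => ?_)
  exact (actionDeriv₂_eq_sum_subtype ρ u _).symm

end MatrixModel

/-! ## §3 The `SU(N)` instance -/

section SpecialUnitary

variable {N : ℕ} [NeZero N] {P : Params} [DecidableEq (PBond P 0)]

/-- ★★ **THE DRESSED ENERGY IDENTITY FOR `SU(N)`** (`ρ = fundamentalRep`, `u` skew-Hermitian traceless so that `exp(t u_b) ∈ SU(N)`;
`β ≥ 0`; any sitewise measurable dressing adapted to `supp u`). [cite: GrossCMP1983, Thm 2.2 (2.9); Chatterjee2019LargeN, §8] -/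
theorem su_dressed_energy_identity {β : ℝ} (hβ : 0 ≤ β)
    (u : PBond P 0 → Matrix (Fin N) (Fin N) ℂ) (hu : ∀ b, star (u b) = -(u b) ∧ (u b).trace = 0)
    (g : GaugeField P 0 (Matrix.specialUnitaryGroup (Fin N) ℂ) → GaugeTransf P 0 (Matrix.specialUnitaryGroup (Fin N) ℂ))
    (hgm : ∀ x, Measurable fun U => g U x)
    (hgb : ∀ (b : PBond P 0), u b ≠ 0 → ∀ (U : GaugeField P 0 (Matrix.specialUnitaryGroup (Fin N) ℂ))
      (x : Matrix.specialUnitaryGroup (Fin N) ℂ), g (Function.update U b x) = g U) :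
    β * ∫ U, actionDeriv (fundamentalRep (Fin N)) u (GaugeField.gaugeAct (g U) U) ^ 2 ∂gibbsMeasure P β =
      ∫ U, actionDeriv₂ (fundamentalRep (Fin N)) u (GaugeField.gaugeAct (g U) U) ∂gibbsMeasure P β := by
  haveI : SecondCountableTopology (Matrix.specialUnitaryGroup (Fin N) ℂ) := by
    haveI := secondCountableTopology_matrix (n := Fin N)
    exact Topology.IsEmbedding.subtypeVal.secondCountableTopology
  have hre : ∀ g : Matrix.specialUnitaryGroup (Fin N) ℂ, reTr g = (fundamentalRep (Fin N) g).trace.re / N := fun g => by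
    show UnitaryModel.nReTr (g : Matrix (Fin N) (Fin N) ℂ) = _
    simp [UnitaryModel.nReTr, Fintype.card_fin]
  choose k hk hkX using fun b => exists_oneParam_specialUnitaryGroup (hu b).1 (hu b).2
  exact dressed_energy_identity_matrixModel (continuous_fundamentalRep (Fin N)) hre u hk hkX hβ g hgm hgb

end SpecialUnitary

/-! ## §4 The registered `stub_condSD`, token for token -/

section Stub

/-- ★★★ **`stub_condSD` (LINE 28 «GrossTransfer», registered skeleton v2 5d16c6d70f019e13 on stmt-QuantumFields-23083) HOLDS** — the second-order Schwinger–Dyson («energy») identity in the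
tree-gauge dressing: for `u` skew-Hermitian traceless, supported on inner OFF-TREE bonds of a non-wrapping box `[lo, hi]`, and `V U = U^{axialGauge U lo hi}`,
`β_K·∫ (∂_u A_W)(V U)² dμ_K = ∫ (∂_u∂_u A_W)(V U) dμ_K` — EXACT, every `γ ≥ 0`, every `K`, no window, no small field.  Proof: §3 with the dressing
`g U := axialGauge U lo hi`, which is sitewise measurable (✓`measurable_axialGauge_apply`) and adapted to every bond of `supp u` (✓`axialGauge_update_of_not_mem_combSet`
at ✓`not_mem_combSet_of_inner_lowPart_ne_zero (nonWrapping_of_side_lt …)`), and `gibbsK F ℰp γ K = gibbsMeasure (F.P K) β_K` (`rfl`).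
[cite: GrossCMP1983, Thm 2.2 (2.7)–(2.9); Chatterjee2019LargeN, §8] -/
theorem stub_condSD :
    ∀ (F : T3Family) (γ : ℝ), 0 ≤ γ → ∀ (K : ℕ) (lo hi : Fin (F.P K).d → ℤ) (n : ℕ)
          (u : PBond (F.P K) 0 → Matrix (Fin 2) (Fin 2) ℂ),
          (∀ κ, lo κ ≤ hi κ ∧ hi κ ≤ lo κ + n) → n < (F.P K).sitesPerDir 0 →
          (∀ b, star (u b) = -(u b) ∧ (u b).trace = 0) →
          (∀ b, u b ≠ 0 → ∃ x : Fin (F.P K).d → ℤ,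
              lo + 1 ≤ x ∧ x + e b.dir + 1 ≤ hi ∧ b.src = castSite x ∧ lowPart b.dir (x - lo) ≠ 0) →
          (F.scheme ℰp γ).β K *
              ∫ U, (actionDeriv (fundamentalRep (Fin 2)) u (GaugeField.gaugeAct (axialGauge U lo hi) U)) ^ 2 ∂(gibbsK F ℰp γ K)
            = ∫ U, actionDeriv₂ (fundamentalRep (Fin 2)) u (GaugeField.gaugeAct (axialGauge U lo hi) U) ∂(gibbsK F ℰp γ K) := by
  intro F γ hγ K lo hi n u hbox hn hu hsupp
  classical
  have hN := nonWrapping_of_side_lt (P := F.P K) (j := 0) hbox hn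
  have hgb : ∀ (b : PBond (F.P K) 0), u b ≠ 0 → ∀ (U : GaugeField (F.P K) 0 (Matrix.specialUnitaryGroup (Fin 2) ℂ))
      (x : Matrix.specialUnitaryGroup (Fin 2) ℂ), axialGauge (Function.update U b x) lo hi = axialGauge U lo hi := by
    intro b hb U x
    obtain ⟨z, hz, hzμ, hsrc, hlow⟩ := hsupp b hb
    exact axialGauge_update_of_not_mem_combSet U (not_mem_combSet_of_inner_lowPart_ne_zero hN hz hzμ hsrc hlow) x
  rw [gibbsK_eq]
  exact su_dressed_energy_identity (F.scheme_β_nonneg ℰp hγ K) u hu (fun U => axialGauge U lo hi)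
    (fun s => measurable_axialGauge_apply lo hi s) hgb

end Stub

end Summit.QuantumFields.YangMills.Theorems.UnitScaleGibbsAxialGaugeCondSD

end
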